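import Summits.Ventures.Crystal3D.Theorems.StickyWulffConstantGenericWallFloorInPlaneTwinOnly
import HarnessLib

/-!
# Twin star pairs that CANNOT meet: the mixed (in-plane × crossing) and the same-side crossing twin pairs are
# vacuously priced (crux `GenericWallFloor`, stmt-Ventures-19480, line `WallLedgerG`)

HONEST FRAMING. Venture `Summits/Ventures/Crystal3D` (cell `crystal3d-full`), helper `--supports` the crux
`GenericWallFloor` of `route-Ventures-StickyWulffConstant`, REGISTERED line `WallLedgerG`, open stub
`stub_twoSlabAdhesion`.  Rung credit + bookkeeping only; F-C1 not moved; NOT the crux: `ExactOnly`(C12-55) [E1] and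
`StarPairFar` [certified] stay BY NAME wherever a ledger is invoked.  CENSUS-FREE (inner products only).

THE QUESTION.  Every two-family charging scheme of the line (the priced ledger `twoSlabAdhesion_stackLedger_cross`,
`…StackLedgerCross`; its count `card_contacts_add_endStates_le_twelve_cross`) must say, for every CO-AXIAL pair of walker
tops `(F₁, v₁)`, `(F₂, v₂)` that could end at one ball `e`, why `e` still pays one missing contact per end.  Co-axial =
equal lattices, or mirror twins `F₂·Λ₀ = (twinFrame F₁ ν)·Λ₀` about a common unit menu normal `ν`.  For twins the tree
prices ONE direction class: both walk directions IN the mirror plane (`InPlaneTwinStarPair`, proved by hand in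
`…InPlaneTwinStarPairHolds`: `deg e ≤ 10`).  This file settles ALL OTHER twin classes but one, census-free:

* `false_of_twin_two_one` / `false_of_twin_one_two` — the mechanism (two lines from `twin_pair_sum`): at one centre of a
  `1`-separated configuration, an `F₁`-slot ball and an `F₂`-slot ball on the SAME side of `ν` are mirror-antipodal
  (`F₁ a + F₂ c = ±2√(2/3) ν`), so two distinct same-side `F₁`-slot balls exclude every same-side `F₂`-slot ball (and
  vice versa).  Geometrically: the lower `F₁`-triangle and the lower `F₂`-triangle under a twin-plane site are the two
  hole families `B`, `C` of the layer, at mutual distance `1/√3 < 1`.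
* `exists_two_star_slots_of_crossing` — the closed star of a CROSSING slot `v` (`⟪F v, ν⟫ = σ√(2/3)`) contains two
  slots of the opposite sign (`−v` and a polar neighbour); the closed star of an IN-PLANE slot contains one slot of each
  sign (`exists_star_slot_off_plane`, tree).
* **`false_of_twinStars_of_sum_ne_zero`** — hence NO ball of a `1`-separated configuration owns both closed stars when
  `⟪F₁ v₁, ν⟫ + ⟪F₂ v₂, ν⟫ ≠ 0`, i.e. for the MIXED pairs (one direction in the mirror plane, the other across it:
  `false_of_twinStars_inPlane_crossing`, `…_crossing_inPlane`) and the SAME-SIDE crossing pairs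
  (`false_of_twinStars_sameSign`).  The only twin classes left are in-plane/in-plane (priced) and OPPOSITE-side crossing
  (`⟪F₁v₁,ν⟫ = −⟪F₂v₂,ν⟫ ≠ 0`: a twin-plane ball entered across the plane from both sides — a vacancy-type double end,
  genuinely possible, pays `½ + ½`).
* `TwinCrossData e₁ e₂`, `hcross_of_twinCrossData` — the WalkEntry packaging in the exact shape of the `hcross`
  hypothesis of `twoSlabAdhesion_stackLedger_cross` (the priced disjunct holds vacuously);
  `false_of_twinCrossData_of_image_eq`.  Sequel `…TwinStarPairCrossClass`: the semantic priced class of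
  `…InPlaneTwinOnly` enlarged by the twin-cross pairs, with the same composition (`c₀ = 1` modulo `ExactOnly`(C12-55),
  `StarPairFar`).

CONSEQUENCE FOR THE ARRIVAL CLASS (R41w bookkeeping): across a coherent twin plane `ν`, a lamella-frame walker crossing
`ν` and a far-grain walker running IN `ν` (or crossing it the same way) never share an end ball; the two-sided sharing
problem of the core is therefore EXACTLY the equal-frame double end (vacancy neighbour) and the opposite-side twin-plane
vacancy — nothing else.
WHAT THIS IS NOT: not the stub; no walk is run here; the arrival residual is untouched; F-C1 not moved.
-/

noncomputable section

namespace Summit.Ventures.Crystal3D.Theorems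

open Summit.Ventures.Crystal3D Finset
open Literature.MathematicalPhysics.StatisticalMechanics (fccStacking barlowStacking IsHaggSeq)
open scoped InnerProductSpace

/-! ### Menu and twin-dozen bookkeeping -/

/-- The twin slot dozen: if `F₂·Λ₀ = (twinFrame F₁ ν)·Λ₀` then every `F₂`-slot is a mirrored `F₁`-slot. -/
theorem exists_mirror_slot_of_twin {F₁ F₂ : EuclideanSpace ℝ (Fin 3) ≃ₗᵢ[ℝ] EuclideanSpace ℝ (Fin 3)}
    {ν : EuclideanSpace ℝ (Fin 3)} (hν : ‖ν‖ = 1)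
    (htwin : F₂ '' fccStacking 1 (Real.sqrt (2 / 3)) = (twinFrame F₁ ν) '' fccStacking 1 (Real.sqrt (2 / 3))) :
    ∀ w ∈ fccSlots, ∃ l ∈ fccSlots, F₂ w = F₁ l - (2 * ⟪F₁ l, ν⟫_ℝ) • ν := by
  intro w hw
  have hslots := image_fccSlots_eq_of_image_fcc_eq _ _ htwin
  have hm : F₂ w ∈ (twinFrame F₁ ν : EuclideanSpace ℝ (Fin 3) → EuclideanSpace ℝ (Fin 3)) '' ↑fccSlots := by
    rw [← hslots]; exact ⟨w, Finset.mem_coe.2 hw, rfl⟩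
  obtain ⟨l, hl, hlw⟩ := hm
  exact ⟨l, Finset.mem_coe.1 hl, by rw [← hlw, twinFrame_apply F₁ hν]⟩

/-- The mirror normal is a menu normal of the twin frame as well. -/
theorem menu_of_twin {F₁ F₂ : EuclideanSpace ℝ (Fin 3) ≃ₗᵢ[ℝ] EuclideanSpace ℝ (Fin 3)} {ν : EuclideanSpace ℝ (Fin 3)}
    (hν : ‖ν‖ = 1)
    (hmenu : ∀ w ∈ fccSlots, ⟪F₁ w, ν⟫_ℝ = 0 ∨ ⟪F₁ w, ν⟫_ℝ = Real.sqrt (2 / 3) ∨ ⟪F₁ w, ν⟫_ℝ = -Real.sqrt (2 / 3))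
    (htwin : F₂ '' fccStacking 1 (Real.sqrt (2 / 3)) = (twinFrame F₁ ν) '' fccStacking 1 (Real.sqrt (2 / 3))) :
    ∀ w ∈ fccSlots, ⟪F₂ w, ν⟫_ℝ = 0 ∨ ⟪F₂ w, ν⟫_ℝ = Real.sqrt (2 / 3) ∨ ⟪F₂ w, ν⟫_ℝ = -Real.sqrt (2 / 3) := by
  have hνν : ⟪ν, ν⟫_ℝ = 1 := by rw [real_inner_self_eq_norm_sq, hν, one_pow]
  intro w hw
  obtain ⟨l, hl, hwl⟩ := exists_mirror_slot_of_twin hν htwin w hw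
  have h' : ⟪F₂ w, ν⟫_ℝ = -⟪F₁ l, ν⟫_ℝ := by rw [hwl, inner_sub_left, real_inner_smul_left, hνν]; ring
  rw [h']
  rcases hmenu l hl with h | h | h
  · exact Or.inl (by rw [h, neg_zero])
  · exact Or.inr (Or.inr (by rw [h]))
  · exact Or.inr (Or.inl (by rw [h, neg_neg]))

/-! ### The mechanism: same-side slot balls of twin frames are mirror-antipodal -/

/-- **Two distinct same-side `F₁`-slot balls exclude every same-side `F₂`-slot ball** at one centre of a `1`-separated
configuration (each would be mirror-antipodal to both, `twin_pair_sum`). -/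
theorem false_of_twin_two_one {F₁ F₂ : EuclideanSpace ℝ (Fin 3) ≃ₗᵢ[ℝ] EuclideanSpace ℝ (Fin 3)}
    {ν : EuclideanSpace ℝ (Fin 3)} (hν : ‖ν‖ = 1)
    (htw : ∀ w ∈ fccSlots, ∃ l ∈ fccSlots, F₂ w = F₁ l - (2 * ⟪F₁ l, ν⟫_ℝ) • ν)
    {X : Finset (EuclideanSpace ℝ (Fin 3))} (hX : ∀ p ∈ X, ∀ q ∈ X, p ≠ q → 1 ≤ dist p q)
    {e a a' c : EuclideanSpace ℝ (Fin 3)} (ha : a ∈ fccSlots) (ha' : a' ∈ fccSlots) (hc : c ∈ fccSlots) (hne : a ≠ a')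
    (haX : e + F₁ a ∈ X) (ha'X : e + F₁ a' ∈ X) (hcX : e + F₂ c ∈ X)
    {σ : ℝ} (hσ : σ = 1 ∨ σ = -1) (haν : ⟪F₁ a, ν⟫_ℝ = σ * Real.sqrt (2 / 3))
    (ha'ν : ⟪F₁ a', ν⟫_ℝ = σ * Real.sqrt (2 / 3)) (hcν : ⟪F₂ c, ν⟫_ℝ = σ * Real.sqrt (2 / 3)) : False := by
  have h1 := twin_pair_sum hν htw hX ha hc haX hcX hσ haν hcν
  have h2 := twin_pair_sum hν htw hX ha' hc ha'X hcX hσ ha'ν hcν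
  exact hne (F₁.injective (add_right_cancel (h1.trans h2.symm)))

/-- **One same-side `F₁`-slot ball excludes two distinct same-side `F₂`-slot balls** (the mirror statement). -/
theorem false_of_twin_one_two {F₁ F₂ : EuclideanSpace ℝ (Fin 3) ≃ₗᵢ[ℝ] EuclideanSpace ℝ (Fin 3)}
    {ν : EuclideanSpace ℝ (Fin 3)} (hν : ‖ν‖ = 1)
    (htw : ∀ w ∈ fccSlots, ∃ l ∈ fccSlots, F₂ w = F₁ l - (2 * ⟪F₁ l, ν⟫_ℝ) • ν)
    {X : Finset (EuclideanSpace ℝ (Fin 3))} (hX : ∀ p ∈ X, ∀ q ∈ X, p ≠ q → 1 ≤ dist p q)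
    {e a c c' : EuclideanSpace ℝ (Fin 3)} (ha : a ∈ fccSlots) (hc : c ∈ fccSlots) (hc' : c' ∈ fccSlots) (hne : c ≠ c')
    (haX : e + F₁ a ∈ X) (hcX : e + F₂ c ∈ X) (hc'X : e + F₂ c' ∈ X)
    {σ : ℝ} (hσ : σ = 1 ∨ σ = -1) (haν : ⟪F₁ a, ν⟫_ℝ = σ * Real.sqrt (2 / 3))
    (hcν : ⟪F₂ c, ν⟫_ℝ = σ * Real.sqrt (2 / 3)) (hc'ν : ⟪F₂ c', ν⟫_ℝ = σ * Real.sqrt (2 / 3)) : False := by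
  have h1 := twin_pair_sum hν htw hX ha hc haX hcX hσ haν hcν
  have h2 := twin_pair_sum hν htw hX ha hc' haX hc'X hσ haν hc'ν
  exact hne (F₂.injective (add_left_cancel (h1.trans h2.symm)))

/-! ### Star contents by sign -/

/-- **The closed star of a CROSSING slot holds two slots of the opposite sign.**  For a unit menu normal `ν` of `F`
and a slot `v` with `⟪F v, ν⟫ = σ√(2/3)` (`σ = ±1`) there are slots `w ≠ w'` with `⟪w, v⟫ < 0`, `⟪w', v⟫ < 0` and
`⟪F w, ν⟫ = ⟪F w', ν⟫ = −σ√(2/3)`: `w = −v` and `w'` a second member of the polar triple of `−v` (pairwise adjacent,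
`inner_eq_half_of_pos_pos`). -/
theorem exists_two_star_slots_of_crossing (F : EuclideanSpace ℝ (Fin 3) ≃ₗᵢ[ℝ] EuclideanSpace ℝ (Fin 3))
    {ν v : EuclideanSpace ℝ (Fin 3)} (hν : ‖ν‖ = 1)
    (hmenu : ∀ w ∈ fccSlots, ⟪F w, ν⟫_ℝ = 0 ∨ ⟪F w, ν⟫_ℝ = Real.sqrt (2 / 3) ∨ ⟪F w, ν⟫_ℝ = -Real.sqrt (2 / 3))
    (hv : v ∈ fccSlots) {σ : ℝ} (hσ : σ = 1 ∨ σ = -1) (hvν : ⟪F v, ν⟫_ℝ = σ * Real.sqrt (2 / 3)) :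
    ∃ w ∈ fccSlots, ∃ w' ∈ fccSlots, w ≠ w' ∧ ⟪w, v⟫_ℝ < 0 ∧ ⟪w', v⟫_ℝ < 0 ∧
      ⟪F w, ν⟫_ℝ = -(σ * Real.sqrt (2 / 3)) ∧ ⟪F w', ν⟫_ℝ = -(σ * Real.sqrt (2 / 3)) := by
  classical
  have hr : 0 < Real.sqrt (2 / 3) := Real.sqrt_pos.2 (by norm_num)
  have hσ2 : σ * σ = 1 := by rcases hσ with rfl | rfl <;> norm_num
  have hσabs : |σ| = 1 := by rcases hσ with rfl | rfl <;> norm_num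
  -- the unit normal `n := −σ ν`, for which `−v` is a positive slot
  set n : EuclideanSpace ℝ (Fin 3) := (-σ) • ν with hn
  have hnn : ‖n‖ = 1 := by rw [hn, norm_smul, Real.norm_eq_abs, abs_neg, hσabs, one_mul, hν]
  have hinn : ∀ x : EuclideanSpace ℝ (Fin 3), ⟪x, n⟫_ℝ = -σ * ⟪x, ν⟫_ℝ := fun x => by
    rw [hn, real_inner_smul_right]
  have hmenu' : ∀ w ∈ fccSlots, ⟪F w, n⟫_ℝ = 0 ∨ ⟪F w, n⟫_ℝ = Real.sqrt (2 / 3) ∨ ⟪F w, n⟫_ℝ = -Real.sqrt (2 / 3) := by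
    intro w hw
    rw [hinn]
    rcases hmenu w hw with h | h | h
    · exact Or.inl (by rw [h, mul_zero])
    · rw [h]
      rcases hσ with rfl | rfl
      · exact Or.inr (Or.inr (by ring))
      · exact Or.inr (Or.inl (by ring))
    · rw [h]
      rcases hσ with rfl | rfl
      · exact Or.inr (Or.inl (by ring))
      · exact Or.inr (Or.inr (by ring))
  have hnegv : -v ∈ fccSlots := neg_mem_fccSlots hv
  have hvn : 0 < ⟪F (-v), n⟫_ℝ := by
    rw [hinn, map_neg, inner_neg_left, hvν]
    nlinarith [hr, hσ2]
  obtain ⟨w₁, hw₁, w₂, hw₂, w₃, hw₃, h12, -, -, hn₁, hn₂, -⟩ := exists_three_far_slots F hnn hmenu'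
  -- a positive slot `w'` of `n` other than `−v`
  obtain ⟨w', hw', hw'ne, hw'n⟩ : ∃ w' ∈ fccSlots, w' ≠ -v ∧ ⟪F w', n⟫_ℝ = Real.sqrt (2 / 3) := by
    by_cases h : w₁ = -v
    · exact ⟨w₂, hw₂, fun h' => h12 (h.trans h'.symm), hn₂⟩
    · exact ⟨w₁, hw₁, h, hn₁⟩
  have hw'pos : 0 < ⟪F w', n⟫_ℝ := by rw [hw'n]; exact hr
  have hhalf : ⟪w', -v⟫_ℝ = 1 / 2 := inner_eq_half_of_pos_pos F hnn hmenu' hw' hnegv hw'ne hw'pos hvn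
  refine ⟨-v, hnegv, w', hw', fun h => hw'ne h.symm, ?_, ?_, ?_, ?_⟩
  · rw [inner_neg_left, real_inner_self_eq_norm_sq, norm_eq_one_of_mem_fccSlots hv]; norm_num
  · rw [inner_neg_right] at hhalf; linarith
  · rw [map_neg, inner_neg_left, hvν]
  · have h' : -σ * ⟪F w', ν⟫_ℝ = Real.sqrt (2 / 3) := by rw [← hinn]; exact hw'n
    have h'' : ⟪F w', ν⟫_ℝ = -σ * (-σ * ⟪F w', ν⟫_ℝ) := by
      rw [← mul_assoc, neg_mul_neg, hσ2, one_mul]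
    rw [h'', h']; ring

/-- The closed star of an IN-PLANE slot holds a slot of either prescribed sign `−σ√(2/3)` (`σ = ±1`):
`exists_star_slot_off_plane` for `ν` and for `−ν`. -/
theorem exists_star_slot_of_inPlane_sign (F : EuclideanSpace ℝ (Fin 3) ≃ₗᵢ[ℝ] EuclideanSpace ℝ (Fin 3))
    {ν v : EuclideanSpace ℝ (Fin 3)} (hν : ‖ν‖ = 1)
    (hmenu : ∀ w ∈ fccSlots, ⟪F w, ν⟫_ℝ = 0 ∨ ⟪F w, ν⟫_ℝ = Real.sqrt (2 / 3) ∨ ⟪F w, ν⟫_ℝ = -Real.sqrt (2 / 3))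
    (hv : v ∈ fccSlots) (hvν : ⟪F v, ν⟫_ℝ = 0) {σ : ℝ} (hσ : σ = 1 ∨ σ = -1) :
    ∃ a ∈ fccSlots, ⟪a, v⟫_ℝ < 0 ∧ ⟪F a, ν⟫_ℝ = -(σ * Real.sqrt (2 / 3)) := by
  rcases hσ with rfl | rfl
  · obtain ⟨b, hb, hbv, hbν⟩ := exists_star_slot_off_plane F hν hmenu hv hvν
    exact ⟨b, hb, hbv, by rw [hbν, one_mul]⟩
  · have hmν : ‖-ν‖ = 1 := by rw [norm_neg, hν]
    -- the menu of `−ν` (cf. `menu_neg` of `…CoaxialWallLawEndUniqueMulti`, not imported here)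
    have hmenu' : ∀ w ∈ fccSlots, ⟪F w, -ν⟫_ℝ = 0 ∨ ⟪F w, -ν⟫_ℝ = Real.sqrt (2 / 3) ∨ ⟪F w, -ν⟫_ℝ = -Real.sqrt (2 / 3) := by
      intro w hw
      rw [inner_neg_right]
      rcases hmenu w hw with h | h | h
      · exact Or.inl (by rw [h, neg_zero])
      · exact Or.inr (Or.inr (by rw [h]))
      · exact Or.inr (Or.inl (by rw [h, neg_neg]))
    obtain ⟨b, hb, hbv, hbν⟩ := exists_star_slot_off_plane F hmν hmenu' hv (by rw [inner_neg_right, hvν, neg_zero])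
    rw [inner_neg_right, neg_inj] at hbν
    exact ⟨b, hb, hbv, by rw [hbν]; ring⟩

/-! ### The excluded twin star pairs -/

/-- **MIXED twin star pair, in-plane × crossing, is impossible**: `F₂·Λ₀ = (twinFrame F₁ ν)·Λ₀`, `⟪F₁ v₁, ν⟫ = 0`,
`⟪F₂ v₂, ν⟫ ≠ 0`; then no ball of a `1`-separated configuration owns the closed star of `−v₁` in `F₁` and the closed
star of `−v₂` in `F₂`. -/
theorem false_of_twinStars_inPlane_crossing {F₁ F₂ : EuclideanSpace ℝ (Fin 3) ≃ₗᵢ[ℝ] EuclideanSpace ℝ (Fin 3)}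
    {ν : EuclideanSpace ℝ (Fin 3)} (hν : ‖ν‖ = 1)
    (hmenu : ∀ w ∈ fccSlots, ⟪F₁ w, ν⟫_ℝ = 0 ∨ ⟪F₁ w, ν⟫_ℝ = Real.sqrt (2 / 3) ∨ ⟪F₁ w, ν⟫_ℝ = -Real.sqrt (2 / 3))
    (htwin : F₂ '' fccStacking 1 (Real.sqrt (2 / 3)) = (twinFrame F₁ ν) '' fccStacking 1 (Real.sqrt (2 / 3)))
    {v₁ v₂ : EuclideanSpace ℝ (Fin 3)} (hv₁ : v₁ ∈ fccSlots) (hv₂ : v₂ ∈ fccSlots)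
    (hv₁ν : ⟪F₁ v₁, ν⟫_ℝ = 0) (hv₂ν : ⟪F₂ v₂, ν⟫_ℝ ≠ 0)
    {X : Finset (EuclideanSpace ℝ (Fin 3))} (hX : ∀ p ∈ X, ∀ q ∈ X, p ≠ q → 1 ≤ dist p q) {e : EuclideanSpace ℝ (Fin 3)}
    (hown₁ : ∀ w ∈ fccSlots, ⟪w, v₁⟫_ℝ < 0 → e + F₁ w ∈ X) (hown₂ : ∀ w ∈ fccSlots, ⟪w, v₂⟫_ℝ < 0 → e + F₂ w ∈ X) :
    False := by
  have htw := exists_mirror_slot_of_twin hν htwin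
  have hmenu₂ := menu_of_twin hν hmenu htwin
  obtain ⟨σ, hσ, hv₂σ⟩ : ∃ σ : ℝ, (σ = 1 ∨ σ = -1) ∧ ⟪F₂ v₂, ν⟫_ℝ = σ * Real.sqrt (2 / 3) := by
    rcases hmenu₂ v₂ hv₂ with h | h | h
    · exact absurd h hv₂ν
    · exact ⟨1, Or.inl rfl, by rw [h, one_mul]⟩
    · exact ⟨-1, Or.inr rfl, by rw [h]; ring⟩
  obtain ⟨c, hc, c', hc', hcc', hcv, hc'v, hcν, hc'ν⟩ := exists_two_star_slots_of_crossing F₂ hν hmenu₂ hv₂ hσ hv₂σ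
  obtain ⟨a, ha, hav, haν⟩ := exists_star_slot_of_inPlane_sign F₁ hν hmenu hv₁ hv₁ν hσ
  have hτ : (-σ) = 1 ∨ (-σ) = -1 := by rcases hσ with rfl | rfl <;> norm_num
  exact false_of_twin_one_two hν htw hX ha hc hc' hcc' (hown₁ a ha hav) (hown₂ c hc hcv) (hown₂ c' hc' hc'v) hτ
    (by rw [haν]; ring) (by rw [hcν]; ring) (by rw [hc'ν]; ring)

/-- **MIXED twin star pair, crossing × in-plane, is impossible** (the mirror case). -/
theorem false_of_twinStars_crossing_inPlane {F₁ F₂ : EuclideanSpace ℝ (Fin 3) ≃ₗᵢ[ℝ] EuclideanSpace ℝ (Fin 3)}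
    {ν : EuclideanSpace ℝ (Fin 3)} (hν : ‖ν‖ = 1)
    (hmenu : ∀ w ∈ fccSlots, ⟪F₁ w, ν⟫_ℝ = 0 ∨ ⟪F₁ w, ν⟫_ℝ = Real.sqrt (2 / 3) ∨ ⟪F₁ w, ν⟫_ℝ = -Real.sqrt (2 / 3))
    (htwin : F₂ '' fccStacking 1 (Real.sqrt (2 / 3)) = (twinFrame F₁ ν) '' fccStacking 1 (Real.sqrt (2 / 3)))
    {v₁ v₂ : EuclideanSpace ℝ (Fin 3)} (hv₁ : v₁ ∈ fccSlots) (hv₂ : v₂ ∈ fccSlots)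
    (hv₁ν : ⟪F₁ v₁, ν⟫_ℝ ≠ 0) (hv₂ν : ⟪F₂ v₂, ν⟫_ℝ = 0)
    {X : Finset (EuclideanSpace ℝ (Fin 3))} (hX : ∀ p ∈ X, ∀ q ∈ X, p ≠ q → 1 ≤ dist p q) {e : EuclideanSpace ℝ (Fin 3)}
    (hown₁ : ∀ w ∈ fccSlots, ⟪w, v₁⟫_ℝ < 0 → e + F₁ w ∈ X) (hown₂ : ∀ w ∈ fccSlots, ⟪w, v₂⟫_ℝ < 0 → e + F₂ w ∈ X) :
    False := by
  have htw := exists_mirror_slot_of_twin hν htwin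
  have hmenu₂ := menu_of_twin hν hmenu htwin
  obtain ⟨σ, hσ, hv₁σ⟩ : ∃ σ : ℝ, (σ = 1 ∨ σ = -1) ∧ ⟪F₁ v₁, ν⟫_ℝ = σ * Real.sqrt (2 / 3) := by
    rcases hmenu v₁ hv₁ with h | h | h
    · exact absurd h hv₁ν
    · exact ⟨1, Or.inl rfl, by rw [h, one_mul]⟩
    · exact ⟨-1, Or.inr rfl, by rw [h]; ring⟩
  obtain ⟨a, ha, a', ha', haa', hav, ha'v, haν, ha'ν⟩ := exists_two_star_slots_of_crossing F₁ hν hmenu hv₁ hσ hv₁σ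
  obtain ⟨c, hc, hcv, hcν⟩ := exists_star_slot_of_inPlane_sign F₂ hν hmenu₂ hv₂ hv₂ν hσ
  have hτ : (-σ) = 1 ∨ (-σ) = -1 := by rcases hσ with rfl | rfl <;> norm_num
  exact false_of_twin_two_one hν htw hX ha ha' hc haa' (hown₁ a ha hav) (hown₁ a' ha' ha'v) (hown₂ c hc hcv) hτ
    (by rw [haν]; ring) (by rw [ha'ν]; ring) (by rw [hcν]; ring)

/-- **SAME-SIDE crossing twin star pair is impossible**: `⟪F₁ v₁, ν⟫ = ⟪F₂ v₂, ν⟫ ≠ 0`. -/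
theorem false_of_twinStars_sameSign {F₁ F₂ : EuclideanSpace ℝ (Fin 3) ≃ₗᵢ[ℝ] EuclideanSpace ℝ (Fin 3)}
    {ν : EuclideanSpace ℝ (Fin 3)} (hν : ‖ν‖ = 1)
    (hmenu : ∀ w ∈ fccSlots, ⟪F₁ w, ν⟫_ℝ = 0 ∨ ⟪F₁ w, ν⟫_ℝ = Real.sqrt (2 / 3) ∨ ⟪F₁ w, ν⟫_ℝ = -Real.sqrt (2 / 3))
    (htwin : F₂ '' fccStacking 1 (Real.sqrt (2 / 3)) = (twinFrame F₁ ν) '' fccStacking 1 (Real.sqrt (2 / 3)))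
    {v₁ v₂ : EuclideanSpace ℝ (Fin 3)} (hv₁ : v₁ ∈ fccSlots) (hv₂ : v₂ ∈ fccSlots)
    (heq : ⟪F₁ v₁, ν⟫_ℝ = ⟪F₂ v₂, ν⟫_ℝ) (hv₁ν : ⟪F₁ v₁, ν⟫_ℝ ≠ 0)
    {X : Finset (EuclideanSpace ℝ (Fin 3))} (hX : ∀ p ∈ X, ∀ q ∈ X, p ≠ q → 1 ≤ dist p q) {e : EuclideanSpace ℝ (Fin 3)}
    (hown₁ : ∀ w ∈ fccSlots, ⟪w, v₁⟫_ℝ < 0 → e + F₁ w ∈ X) (hown₂ : ∀ w ∈ fccSlots, ⟪w, v₂⟫_ℝ < 0 → e + F₂ w ∈ X) :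
    False := by
  have htw := exists_mirror_slot_of_twin hν htwin
  have hmenu₂ := menu_of_twin hν hmenu htwin
  obtain ⟨σ, hσ, hv₁σ⟩ : ∃ σ : ℝ, (σ = 1 ∨ σ = -1) ∧ ⟪F₁ v₁, ν⟫_ℝ = σ * Real.sqrt (2 / 3) := by
    rcases hmenu v₁ hv₁ with h | h | h
    · exact absurd h hv₁ν
    · exact ⟨1, Or.inl rfl, by rw [h, one_mul]⟩
    · exact ⟨-1, Or.inr rfl, by rw [h]; ring⟩
  have hv₂σ : ⟪F₂ v₂, ν⟫_ℝ = σ * Real.sqrt (2 / 3) := heq ▸ hv₁σ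
  obtain ⟨a, ha, a', ha', haa', hav, ha'v, haν, ha'ν⟩ := exists_two_star_slots_of_crossing F₁ hν hmenu hv₁ hσ hv₁σ
  obtain ⟨c, hc, -, -, -, hcv, -, hcν, -⟩ := exists_two_star_slots_of_crossing F₂ hν hmenu₂ hv₂ hσ hv₂σ
  have hτ : (-σ) = 1 ∨ (-σ) = -1 := by rcases hσ with rfl | rfl <;> norm_num
  exact false_of_twin_two_one hν htw hX ha ha' hc haa' (hown₁ a ha hav) (hown₁ a' ha' ha'v) (hown₂ c hc hcv) hτ
    (by rw [haν]; ring) (by rw [ha'ν]; ring) (by rw [hcν]; ring)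

/-- **The sum criterion.**  Twin frames about `ν`, slots `v₁`, `v₂` with `⟪F₁ v₁, ν⟫ + ⟪F₂ v₂, ν⟫ ≠ 0` (equivalently:
not both in the mirror plane and not crossing it from opposite sides): no ball of a `1`-separated configuration owns
both closed stars. -/
theorem false_of_twinStars_of_sum_ne_zero {F₁ F₂ : EuclideanSpace ℝ (Fin 3) ≃ₗᵢ[ℝ] EuclideanSpace ℝ (Fin 3)}
    {ν : EuclideanSpace ℝ (Fin 3)} (hν : ‖ν‖ = 1)
    (hmenu : ∀ w ∈ fccSlots, ⟪F₁ w, ν⟫_ℝ = 0 ∨ ⟪F₁ w, ν⟫_ℝ = Real.sqrt (2 / 3) ∨ ⟪F₁ w, ν⟫_ℝ = -Real.sqrt (2 / 3))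
    (htwin : F₂ '' fccStacking 1 (Real.sqrt (2 / 3)) = (twinFrame F₁ ν) '' fccStacking 1 (Real.sqrt (2 / 3)))
    {v₁ v₂ : EuclideanSpace ℝ (Fin 3)} (hv₁ : v₁ ∈ fccSlots) (hv₂ : v₂ ∈ fccSlots)
    (hsum : ⟪F₁ v₁, ν⟫_ℝ + ⟪F₂ v₂, ν⟫_ℝ ≠ 0)
    {X : Finset (EuclideanSpace ℝ (Fin 3))} (hX : ∀ p ∈ X, ∀ q ∈ X, p ≠ q → 1 ≤ dist p q) {e : EuclideanSpace ℝ (Fin 3)}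
    (hown₁ : ∀ w ∈ fccSlots, ⟪w, v₁⟫_ℝ < 0 → e + F₁ w ∈ X) (hown₂ : ∀ w ∈ fccSlots, ⟪w, v₂⟫_ℝ < 0 → e + F₂ w ∈ X) :
    False := by
  have hmenu₂ := menu_of_twin hν hmenu htwin
  by_cases h₁ : ⟪F₁ v₁, ν⟫_ℝ = 0
  · exact false_of_twinStars_inPlane_crossing hν hmenu htwin hv₁ hv₂ h₁
      (fun h₂ => hsum (by rw [h₁, h₂, add_zero])) hX hown₁ hown₂
  by_cases h₂ : ⟪F₂ v₂, ν⟫_ℝ = 0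
  · exact false_of_twinStars_crossing_inPlane hν hmenu htwin hv₁ hv₂ h₁ h₂ hX hown₁ hown₂
  have heq : ⟪F₁ v₁, ν⟫_ℝ = ⟪F₂ v₂, ν⟫_ℝ := by
    rcases hmenu v₁ hv₁ with h | h | h
    · exact absurd h h₁
    · rcases hmenu₂ v₂ hv₂ with h' | h' | h'
      · exact absurd h' h₂
      · rw [h, h']
      · exact absurd (by rw [h, h']; ring) hsum
    · rcases hmenu₂ v₂ hv₂ with h' | h' | h'
      · exact absurd h' h₂
      · exact absurd (by rw [h, h']; ring) hsum
      · rw [h, h']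
  exact false_of_twinStars_sameSign hν hmenu htwin hv₁ hv₂ heq h₁ hX hown₁ hown₂

/-! ### Walk-entry packaging: twin-cross data is vacuously priced -/

/-- **Twin-cross data** for an ordered pair of walk entries: `e₂.frame` is the mirror twin of `e₁.frame` about a unit menu
normal `ν` of `e₁.frame`, and the `ν`-components of the two walk directions do NOT cancel — one direction in the mirror
plane and the other across it, or both across it on the same side. -/
def TwinCrossData (e₁ e₂ : WalkEntry) : Prop :=
  ∃ ν : EuclideanSpace ℝ (Fin 3), ‖ν‖ = 1 ∧
    (∀ w ∈ fccSlots, ⟪e₁.frame w, ν⟫_ℝ = 0 ∨ ⟪e₁.frame w, ν⟫_ℝ = Real.sqrt (2 / 3) ∨ ⟪e₁.frame w, ν⟫_ℝ = -Real.sqrt (2 / 3)) ∧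
    e₂.frame '' fccStacking 1 (Real.sqrt (2 / 3)) = twinFrame e₁.frame ν '' fccStacking 1 (Real.sqrt (2 / 3)) ∧
    ⟪e₁.frame e₁.dir, ν⟫_ℝ + ⟪e₂.frame e₂.dir, ν⟫_ℝ ≠ 0

/-- **Twin-cross pairs are vacuously priced**: no ball of a `1`-separated configuration owns both closed stars, so the
priced disjunct of the `hcross` hypothesis of `twoSlabAdhesion_stackLedger_cross` /
`card_contacts_add_endStates_le_twelve_cross` holds for the pair. -/
theorem hcross_of_twinCrossData {e₁ e₂ : WalkEntry} (hd₁ : e₁.dir ∈ fccSlots) (hd₂ : e₂.dir ∈ fccSlots)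
    (h : TwinCrossData e₁ e₂ ∨ TwinCrossData e₂ e₁) :
    ∀ (Y : Finset (EuclideanSpace ℝ (Fin 3))), (∀ p ∈ Y, ∀ q ∈ Y, p ≠ q → 1 ≤ dist p q) → ∀ y ∈ Y,
      (∀ w ∈ fccSlots, ⟪w, e₁.dir⟫_ℝ < 0 → y + e₁.frame w ∈ Y) →
      (∀ w ∈ fccSlots, ⟪w, e₂.dir⟫_ℝ < 0 → y + e₂.frame w ∈ Y) →
      starSet y e₁.frame e₁.dir ≠ starSet y e₂.frame e₂.dir ∧
        ∀ q ∈ Y, dist y q = 1 → q ∈ starSet y e₁.frame e₁.dir ∪ starSet y e₂.frame e₂.dir := by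
  intro Y hY y _ hown₁ hown₂
  exfalso
  rcases h with ⟨ν, hν, hmenu, htwin, hsum⟩ | ⟨ν, hν, hmenu, htwin, hsum⟩
  · exact false_of_twinStars_of_sum_ne_zero hν hmenu htwin hd₁ hd₂ hsum hY hown₁ hown₂
  · exact false_of_twinStars_of_sum_ne_zero hν hmenu htwin hd₂ hd₁ hsum hY hown₂ hown₁

/-- A frame carrying twin-cross data against itself-as-a-lattice is absurd: the twin moves the lattice. -/
theorem false_of_twinCrossData_of_image_eq {e₁ e₂ : WalkEntry} (h : TwinCrossData e₁ e₂ ∨ TwinCrossData e₂ e₁)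
    (hEq : e₁.frame '' fccStacking 1 (Real.sqrt (2 / 3)) = e₂.frame '' fccStacking 1 (Real.sqrt (2 / 3))) : False := by
  rcases h with ⟨ν, hν, hmenu, himg, -⟩ | ⟨ν, hν, hmenu, himg, -⟩
  · exact image_twinFrame_ne e₁.frame hν hmenu (himg.symm.trans hEq.symm)
  · exact image_twinFrame_ne e₂.frame hν hmenu (himg.symm.trans hEq)

end Summit.Ventures.Crystal3D.Theorems

end
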